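import Summits.SmoothPoincare4.SmoothPoincare4.Theses.InformationMetricHadamard
import Summits.SmoothPoincare4.SmoothPoincare4.Theorems.InformationMetricHadamardC0AhRecognitionStubFarCollarImmersive
import Summits.SmoothPoincare4.SmoothPoincare4.Theorems.InformationMetricHadamardC0AhRecognitionStubFarCollarIsFar
import Summits.SmoothPoincare4.SmoothPoincare4.Theorems.InformationMetricHadamardC0AhRecognitionStubFarCollarPackage
import Summits.SmoothPoincare4.SmoothPoincare4.Theorems.InformationMetricHadamardC0AhRecognitionStubNearestPointSpread
import Summits.SmoothPoincare4.SmoothPoincare4.Theorems.InformationMetricHadamardC0AhRecognitionStubNearLevelSection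
import Summits.SmoothPoincare4.SmoothPoincare4.Theorems.InformationMetricHadamardC0AhRecognitionStubExpDifferentialNormGe
import Summits.SmoothPoincare4.SmoothPoincare4.Theorems.InformationMetricHadamardC0AhRecognitionStubNormSubLeEdist
import Summits.SmoothPoincare4.SmoothPoincare4.Theorems.InformationMetricHadamardC0AhRecognitionStubFlowToRoundSphere
import Summits.SmoothPoincare4.SmoothPoincare4.Theorems.InformationMetricHadamardC0AhRecognitionStubGradientLikeFieldAux1
import Literature.Geometry.Riemannian.CartanHadamardConjugate
import Literature.Geometry.Riemannian.CartanHadamardLift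
import Mathlib.Geometry.Manifold.PartitionOfUnity
import Mathlib.Geometry.Manifold.ContMDiffMFDeriv
import Mathlib.Topology.MetricSpace.HausdorffDistance
import Mathlib.Analysis.Calculus.Deriv.MeanValue
import Mathlib.Analysis.SpecialFunctions.Sqrt

/-!
# Line `core-distance-morse` — CLOSED (lead a1, 2026-08-16 21:25Z): monolithic kernel check of the crux

This workfile concatenates the lead's E1 files (helpers 2–6 and the apex stub `stub_gradientLikeField`,
sources `work/E1/{Aux2,Aux6,Aux3,Aux4,Main}.lean` of the lead's folder; helper 1 is imported from its landed
module) with the registered composition `C0AhRecognition_of`, importing the six LANDED worker stubs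
(P p117424, N p120988, E2 p123840, R p121637, L p122030, E3 p125064) and E1 helper 1 (p125286).
`lean check`: rc 0, 0 sorries, 0 warnings; audit: proof-of-item `C0AhRecognition_of` closed = true for
`Summit.SmoothPoincare4.SmoothPoincare4.Theses.InformationMetricHadamard.C0AhRecognition`.
The same content is landing as separate Theorems files (Aux2 p125462 ✓, Aux3 p125640 ✓, Aux4 p125907 ✓,
Aux6 p125820 ✓, main p126432 pending farm olean lag), after which the thin composition file
`Theorems/InformationMetricHadamardC0AhRecognition.lean` closes the item.
-/

noncomputable section

set_option linter.dupNamespace false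

open scoped Manifold ContDiff Topology ENNReal NNReal
open Set Function Bundle Filter

namespace Summit.SmoothPoincare4.SmoothPoincare4.Cruxes.C0AhRecognition.CoreDistanceMorse

open Literature.Topology.FourManifolds (HomotopySphere)
open Literature.Geometry.Lorentzian (PseudoRiemannianMetric IsGeodesicallyComplete)
open Literature.Geometry.Riemannian (expMap)

set_option backward.isDefEq.respectTransparency false in
set_option maxHeartbeats 800000 in
/-- **E1 helper 2 (derivative of the distance from a point along a curve).** Let
`Ex p : ℝ⁵ ≅ W` be polar diffeomorphisms of the Riemannian `(W, G)`:
`d_G(p, Ex p u) = |u|_{G_p}`, Gauss lemma `G(d(Ex p)_u u, d(Ex p)_u w) = G_p(u, w)`, reversal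
`(Ex (Ex p u))⁻¹ p = −d(Ex p)_u u`. If `γ` has velocity `V` at `s` within `S` and `γ s ≠ k`, then
`t ↦ d_G(k, γ t)` has derivative `−G((Ex (γ s))⁻¹ k, V) / d_G(k, γ s)` at `s` within `S`
(chain rule through `d_G(k, ·) = |(Ex k)⁻¹ ·|_{G_k}`, then Gauss + reversal to move the formula
to the point `γ s`). [cite: Lee2018, Thm. 6.32 and Cor. 6.12] -/
theorem helper_gradientLikeField_2 :
    ∀ (W : Type) [TopologicalSpace W] [T2Space W] [SecondCountableTopology W]
    [ChartedSpace (EuclideanSpace ℝ (Fin 5)) W] [IsManifold (𝓡 5) ∞ W]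
    (G : Literature.Geometry.Lorentzian.PseudoRiemannianMetric (𝓡 5) ∞ (EuclideanSpace ℝ (Fin 5))
      (TangentSpace (𝓡 5) : W → Type _)) (hG : G.IsRiemannian)
    (Ex : W → (EuclideanSpace ℝ (Fin 5) ≃ₘ^∞⟮𝓡 5, 𝓡 5⟯ W)),
    (∀ (p : W) (u : EuclideanSpace ℝ (Fin 5)),
      G.edist hG p (Ex p u) = ENNReal.ofReal (Real.sqrt (G.val p u u))) →
    (∀ (p : W) (u w : EuclideanSpace ℝ (Fin 5)),
      G.val (Ex p u) (mfderiv (𝓡 5) (𝓡 5) (Ex p) u u) (mfderiv (𝓡 5) (𝓡 5) (Ex p) u w) =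
        G.val p u w) →
    (∀ (p : W) (u : EuclideanSpace ℝ (Fin 5)),
      (Ex (Ex p u)).symm p = -(mfderiv (𝓡 5) (𝓡 5) (Ex p) u u)) →
    ∀ (k : W) (γ : ℝ → W) (S : Set ℝ) (s : ℝ) (V : EuclideanSpace ℝ (Fin 5)),
      HasMFDerivWithinAt 𝓘(ℝ, ℝ) (𝓡 5) γ S s ((1 : ℝ →L[ℝ] ℝ).smulRight V) → γ s ≠ k →
      HasDerivWithinAt (fun t : ℝ ↦ (G.edist hG k (γ t)).toReal)
        (-(G.val (γ s) ((Ex (γ s)).symm k) V) / (G.edist hG k (γ s)).toReal) S s := by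
  intro W _ _ _ _ _ G hG Ex hpol hgauss hrev k γ S s V hγ hne
  -- notation: `Φ = Ex k`, `u t = Φ⁻¹ (γ t)`, `Q v = G_k(v, v)`
  set Φ := Ex k with hΦ
  have hnn : ∀ (x : W) (v : TangentSpace (𝓡 5) x), 0 ≤ G.val x v v := fun x v ↦ by
    by_cases hv : v = 0
    · subst hv; simp
    · exact (hG x v hv).le
  -- `d_G(k, z) = √(G_k(Φ⁻¹ z, Φ⁻¹ z))`
  have hdist : ∀ z : W, (G.edist hG k z).toReal = Real.sqrt (G.val k (Φ.symm z) (Φ.symm z)) := by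
    intro z
    have h := hpol k (Φ.symm z)
    rw [← hΦ, Φ.apply_symm_apply] at h
    rw [h, ENNReal.toReal_ofReal (Real.sqrt_nonneg _)]
  have hfun : (fun t : ℝ ↦ (G.edist hG k (γ t)).toReal) =
      fun t ↦ Real.sqrt (G.val k (Φ.symm (γ t)) (Φ.symm (γ t))) := funext fun t ↦ hdist (γ t)
  -- the curve `β = Φ⁻¹ ∘ γ` in `ℝ⁵` and its velocity `w₀ = dΦ⁻¹(V)`
  set β : ℝ → EuclideanSpace ℝ (Fin 5) := fun t ↦ Φ.symm (γ t) with hβdef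
  set w₀ : EuclideanSpace ℝ (Fin 5) := mfderiv (𝓡 5) (𝓡 5) Φ.symm (γ s) V with hw₀
  have hΦs : HasMFDerivAt (𝓡 5) (𝓡 5) Φ.symm (γ s) (mfderiv (𝓡 5) (𝓡 5) Φ.symm (γ s)) :=
    (Φ.symm.contMDiff.mdifferentiableAt (by simp)).hasMFDerivAt
  have hβm : HasMFDerivWithinAt 𝓘(ℝ, ℝ) (𝓡 5) β S s
      ((mfderiv (𝓡 5) (𝓡 5) Φ.symm (γ s)).comp ((1 : ℝ →L[ℝ] ℝ).smulRight V)) :=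
    hΦs.comp_hasMFDerivWithinAt s hγ
  have hβ : HasDerivWithinAt β w₀ S s := by
    rw [hasDerivWithinAt_iff_hasFDerivWithinAt, ← hasMFDerivWithinAt_iff_hasFDerivWithinAt]
    apply hβm.congr_mfderiv
    rw [ContinuousLinearMap.ext_iff]
    intro a
    rw [ContinuousLinearMap.comp_apply, ContinuousLinearMap.smulRight_apply, map_smul, hw₀]
    rfl
  -- `Q ∘ β` and its derivative `2 G_k(u, w₀)`
  set u : EuclideanSpace ℝ (Fin 5) := Φ.symm (γ s) with hu
  have hβs : β s = u := rfl
  set B : EuclideanSpace ℝ (Fin 5) →L[ℝ] EuclideanSpace ℝ (Fin 5) →L[ℝ] ℝ := G.val k with hB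
  have hBval : ∀ v w : EuclideanSpace ℝ (Fin 5), B v w = G.val k v w := fun _ _ ↦ rfl
  have hc : HasDerivWithinAt (fun t ↦ B (β t)) (B w₀) S s :=
    B.hasFDerivAt.comp_hasDerivWithinAt s hβ
  have hQ : HasDerivWithinAt (fun t ↦ B (β t) (β t)) (B w₀ u + B u w₀) S s := by
    have h := hc.clm_apply hβ
    rw [hβs] at h
    exact h
  have hQ' : HasDerivWithinAt (fun t ↦ G.val k (Φ.symm (γ t)) (Φ.symm (γ t)))
      (2 * G.val k u w₀) S s := by
    have h2 : B w₀ u + B u w₀ = 2 * G.val k u w₀ := by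
      rw [hBval, hBval, G.symm k w₀ u]; ring
    rw [← h2]
    exact hQ
  -- `u ≠ 0` since `γ s ≠ k`
  have hu0 : u ≠ 0 := by
    intro h0
    apply hne
    have : Φ u = γ s := by rw [hu]; exact Φ.apply_symm_apply _
    rw [← this, h0]
    -- `Φ 0 = k`: from the polar distance, `d(k, Φ 0) = 0`
    have hd : G.edist hG k (Φ 0) = 0 := by
      rw [hΦ, hpol k 0]
      have h00 : G.val k (0 : EuclideanSpace ℝ (Fin 5)) (0 : EuclideanSpace ℝ (Fin 5)) = 0 := by
        rw [← hBval 0 0, map_zero]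
      rw [h00, Real.sqrt_zero, ENNReal.ofReal_zero]
    haveI : LocallyCompactSpace W := ChartedSpace.locallyCompactSpace (EuclideanSpace ℝ (Fin 5)) W
    exact ((G.edist_eq_zero_iff hG).1 hd).symm
  have hQpos : G.val k u u ≠ 0 := (hG k u hu0).ne'
  -- the square root
  have hsqrt : HasDerivWithinAt (fun t ↦ Real.sqrt (G.val k (Φ.symm (γ t)) (Φ.symm (γ t))))
      (2 * G.val k u w₀ / (2 * Real.sqrt (G.val k u u))) S s := hQ'.sqrt hQpos
  have hval : 2 * G.val k u w₀ / (2 * Real.sqrt (G.val k u u)) =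
      G.val k u w₀ / Real.sqrt (G.val k u u) := by
    rw [mul_div_mul_left _ _ (two_ne_zero)]
  rw [hval] at hsqrt
  -- move the formula to the point `γ s`: Gauss lemma + reversal
  have hV : mfderiv (𝓡 5) (𝓡 5) Φ u w₀ = V := by
    rw [hu, hw₀]
    exact mfderiv_apply_mfderiv_symm Φ (γ s) V
  have hz : Φ u = γ s := by rw [hu]; exact Φ.apply_symm_apply _
  have hnum : G.val k u w₀ = -(G.val (γ s) ((Ex (γ s)).symm k) V) := by
    have h1 := hgauss k u w₀
    rw [← hΦ, hV] at h1
    -- `(Ex (Φ u))⁻¹ k = -d(Ex k)_u u`, with the negation read in `T_{Φ u}W`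
    have h3 := hrev k u
    rw [← hΦ] at h3
    have h3T : (Ex (Φ u)).symm k =
        (-(mfderiv (𝓡 5) (𝓡 5) Φ u u) : TangentSpace (𝓡 5) (Φ u)) := h3
    have hsw : G.val (Φ u) ((Ex (Φ u)).symm k) V = -(G.val (Φ u) (mfderiv (𝓡 5) (𝓡 5) Φ u u) V) :=
      calc G.val (Φ u) ((Ex (Φ u)).symm k) V = G.val (Φ u) V ((Ex (Φ u)).symm k) := G.symm _ _ _
        _ = G.val (Φ u) V (-(mfderiv (𝓡 5) (𝓡 5) Φ u u) : TangentSpace (𝓡 5) (Φ u)) := by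
            rw [h3T]
        _ = -(G.val (Φ u) V (mfderiv (𝓡 5) (𝓡 5) Φ u u)) := map_neg (G.val (Φ u) V) _
        _ = -(G.val (Φ u) (mfderiv (𝓡 5) (𝓡 5) Φ u u) V) := by rw [G.symm]
    have key : G.val k u w₀ = -(G.val (Φ u) ((Ex (Φ u)).symm k) V) := by
      rw [hsw, neg_neg, h1]
    rw [hz] at key
    exact key
  have hden : Real.sqrt (G.val k u u) = (G.edist hG k (γ s)).toReal := by
    rw [hdist (γ s)]
  rw [hfun]
  rw [hnum, hden] at hsqrt
  exact hsqrt


set_option backward.isDefEq.respectTransparency false in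
set_option maxHeartbeats 1600000 in
/-- **E1 helper 6 (the unit radial field from a point).** In the polar package (`Ex p 0 = p`,
`d_G(p, Ex p u) = |u|_{G_p}`, Gauss lemma `G(d(Ex p)_u u, d(Ex p)_u w) = G_p(u, w)`, reversal
`(Ex (Ex p u))⁻¹ p = −d(Ex p)_u u`), for every `p` the field
`Y z = d(Ex p)_u((√G_p(u,u))⁻¹ u)`, `u = (Ex p)⁻¹ z`, is `C^∞` as a section of `TW` on `{z ≠ p}`,
has `G(Y, Y) = 1` there, equals `−(d_G(p, z))⁻¹ (Ex z)⁻¹ p`, and `Y (Ex p u) = d(Ex p)_u((√G_p(u,u))⁻¹ u)`.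
(Lee 2018, Prop. 5.19 with Cor. 6.12: the radial unit field is the push-forward of `∂_r`.)
[cite: Lee2018, Prop. 5.19 and Cor. 6.12] -/
theorem helper_gradientLikeField_6 :
    ∀ (W : Type) [TopologicalSpace W] [T2Space W] [SecondCountableTopology W]
    [ChartedSpace (EuclideanSpace ℝ (Fin 5)) W] [IsManifold (𝓡 5) ∞ W]
    (G : Literature.Geometry.Lorentzian.PseudoRiemannianMetric (𝓡 5) ∞ (EuclideanSpace ℝ (Fin 5))
      (TangentSpace (𝓡 5) : W → Type _)) (hG : G.IsRiemannian)
    (Ex : W → (EuclideanSpace ℝ (Fin 5) ≃ₘ^∞⟮𝓡 5, 𝓡 5⟯ W)),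
    (∀ p : W, Ex p 0 = p) →
    (∀ (p : W) (u : EuclideanSpace ℝ (Fin 5)),
      G.edist hG p (Ex p u) = ENNReal.ofReal (Real.sqrt (G.val p u u))) →
    (∀ (p : W) (u w : EuclideanSpace ℝ (Fin 5)),
      G.val (Ex p u) (mfderiv (𝓡 5) (𝓡 5) (Ex p) u u) (mfderiv (𝓡 5) (𝓡 5) (Ex p) u w) =
        G.val p u w) →
    (∀ (p : W) (u : EuclideanSpace ℝ (Fin 5)),
      (Ex (Ex p u)).symm p = -(mfderiv (𝓡 5) (𝓡 5) (Ex p) u u)) →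
    ∀ p : W, ∃ Y : Π z : W, TangentSpace (𝓡 5) z,
      ContMDiffOn (𝓡 5) (𝓡 5).tangent ∞ (fun z ↦ (⟨z, Y z⟩ : TangentBundle (𝓡 5) W))
        {z : W | z ≠ p} ∧
      (∀ z : W, z ≠ p → G.val z (Y z) (Y z) = 1) ∧
      (∀ z : W, z ≠ p → Y z = -((G.edist hG p z).toReal⁻¹ • (Ex z).symm p)) ∧
      (∀ u : EuclideanSpace ℝ (Fin 5),
        Y (Ex p u) = mfderiv (𝓡 5) (𝓡 5) (Ex p) u ((Real.sqrt (G.val p u u))⁻¹ • u)) := by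
  intro W _ _ _ _ _ G hG Ex h0 hpol hgauss hrev p
  set Φ := Ex p with hΦ
  -- the radial field on `ℝ⁵ ∖ {0}` and its push-forward
  set c : EuclideanSpace ℝ (Fin 5) → ℝ := fun u ↦ (Real.sqrt (G.val p u u))⁻¹ with hc
  set g : EuclideanSpace ℝ (Fin 5) → EuclideanSpace ℝ (Fin 5) := fun u ↦ c u • u with hg
  set Y : Π z : W, TangentSpace (𝓡 5) z :=
    fun z ↦ mfderiv (𝓡 5) (𝓡 5) Φ (Φ.symm z) (g (Φ.symm z)) with hY
  have hΦz : ∀ z : W, Φ (Φ.symm z) = z := fun z ↦ Φ.apply_symm_apply z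
  have hu0 : ∀ z : W, z ≠ p → Φ.symm z ≠ 0 := by
    intro z hz h
    apply hz
    rw [← hΦz z, h, hΦ]
    exact h0 p
  have hQpos : ∀ u : EuclideanSpace ℝ (Fin 5), u ≠ 0 → 0 < G.val p u u := fun u hu ↦ hG p u hu
  refine ⟨Y, ?_, ?_, ?_, ?_⟩
  · -- ### smoothness on `{z ≠ p}`: `T(Ex p) ∘ (u ↦ (u, g u)) ∘ (Ex p)⁻¹`
    -- `g` is smooth on `{u ≠ 0}`
    set B : EuclideanSpace ℝ (Fin 5) →L[ℝ] EuclideanSpace ℝ (Fin 5) →L[ℝ] ℝ := G.val p with hB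
    have hQ : ContDiff ℝ ∞ (fun u : EuclideanSpace ℝ (Fin 5) ↦ B u u) :=
      (B.isBoundedBilinearMap.contDiff).comp (contDiff_id.prodMk contDiff_id)
    have hgs : ContDiffOn ℝ ∞ g {u : EuclideanSpace ℝ (Fin 5) | u ≠ 0} := by
      intro u hu
      have hQu : B u u ≠ 0 := (hQpos u hu).ne'
      have hsq : ContDiffAt ℝ ∞ (fun u : EuclideanSpace ℝ (Fin 5) ↦ Real.sqrt (B u u)) u :=
        (hQ.contDiffAt).sqrt hQu
      have hsq0 : Real.sqrt (B u u) ≠ 0 := (Real.sqrt_pos.2 (hQpos u hu)).ne'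
      exact ((hsq.inv hsq0).smul contDiffAt_id).contDiffWithinAt
    have hsec : ContMDiffOn 𝓘(ℝ, EuclideanSpace ℝ (Fin 5))
        (𝓘(ℝ, EuclideanSpace ℝ (Fin 5)).prod 𝓘(ℝ, EuclideanSpace ℝ (Fin 5))) ∞
        (fun u : EuclideanSpace ℝ (Fin 5) ↦ (TotalSpace.mk' (EuclideanSpace ℝ (Fin 5)) u (g u) :
          TangentBundle 𝓘(ℝ, EuclideanSpace ℝ (Fin 5)) (EuclideanSpace ℝ (Fin 5))))
        {u : EuclideanSpace ℝ (Fin 5) | u ≠ 0} :=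
      contMDiffOn_vectorSpace_iff_contDiffOn.2 hgs
    have hktop : (∞ : ℕ∞ω) + 1 ≤ (∞ : ℕ∞ω) := le_of_eq rfl
    have hT : ContMDiff (𝓡 5).tangent (𝓡 5).tangent ∞ (tangentMap (𝓡 5) (𝓡 5) Φ) :=
      Φ.contMDiff.contMDiff_tangentMap hktop
    have hsymm : ContMDiffOn (𝓡 5) (𝓡 5) ∞ Φ.symm {z : W | z ≠ p} := Φ.symm.contMDiff.contMDiffOn
    have hmaps : MapsTo Φ.symm {z : W | z ≠ p} {u : EuclideanSpace ℝ (Fin 5) | u ≠ 0} :=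
      fun z hz ↦ hu0 z hz
    have hcomp : ContMDiffOn (𝓡 5) (𝓡 5).tangent ∞
        (fun z ↦ tangentMap (𝓡 5) (𝓡 5) Φ
          (TotalSpace.mk' (EuclideanSpace ℝ (Fin 5)) (Φ.symm z) (g (Φ.symm z)) :
            TangentBundle 𝓘(ℝ, EuclideanSpace ℝ (Fin 5)) (EuclideanSpace ℝ (Fin 5))))
        {z : W | z ≠ p} :=
      hT.comp_contMDiffOn (hsec.comp hsymm hmaps)
    refine hcomp.congr fun z _ ↦ ?_
    -- pointwise: `⟨z, Y z⟩ = T(Ex p) ⟨(Ex p)⁻¹ z, g ((Ex p)⁻¹ z)⟩`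
    rw [TotalSpace.ext_iff]
    refine ⟨?_, ?_⟩
    · show z = Φ (Φ.symm z)
      exact (hΦz z).symm
    · exact HEq.rfl
  · -- ### `G(Y, Y) = 1`
    intro z hz
    set u := Φ.symm z with hu
    have huz : Φ u = z := hΦz z
    have hu' : u ≠ 0 := hu0 z hz
    have hQ : 0 < G.val p u u := hQpos u hu'
    have hsq : 0 < Real.sqrt (G.val p u u) := Real.sqrt_pos.2 hQ
    have hYu : Y (Φ u) = mfderiv (𝓡 5) (𝓡 5) Φ u (c u • u) := by
      show mfderiv (𝓡 5) (𝓡 5) Φ (Φ.symm (Φ u)) (g (Φ.symm (Φ u))) = _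
      rw [Φ.symm_apply_apply]
    have hlin : mfderiv (𝓡 5) (𝓡 5) Φ u (c u • u) = c u • mfderiv (𝓡 5) (𝓡 5) Φ u u :=
      ContinuousLinearMap.map_smul _ _ _
    have e1 : G.val (Φ u) (c u • mfderiv (𝓡 5) (𝓡 5) Φ u u) =
        c u • G.val (Φ u) (mfderiv (𝓡 5) (𝓡 5) Φ u u) := ContinuousLinearMap.map_smul _ _ _
    have e2 : G.val (Φ u) (mfderiv (𝓡 5) (𝓡 5) Φ u u) (c u • mfderiv (𝓡 5) (𝓡 5) Φ u u) =
        c u • G.val (Φ u) (mfderiv (𝓡 5) (𝓡 5) Φ u u) (mfderiv (𝓡 5) (𝓡 5) Φ u u) :=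
      ContinuousLinearMap.map_smul _ _ _
    have hval : G.val (Φ u) (Y (Φ u)) (Y (Φ u)) = 1 := by
      rw [hYu, hlin, e1, _root_.smul_apply, e2, hgauss p u u, smul_eq_mul, smul_eq_mul]
      show (Real.sqrt (G.val p u u))⁻¹ * ((Real.sqrt (G.val p u u))⁻¹ * G.val p u u) = 1
      rw [← mul_assoc, ← mul_inv, Real.mul_self_sqrt hQ.le, inv_mul_cancel₀ hQ.ne']
    rw [huz] at hval
    exact hval
  · -- ### `Y z = -(d(p, z))⁻¹ (Ex z)⁻¹ p`
    intro z hz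
    set u := Φ.symm z with hu
    have huz : Φ u = z := hΦz z
    have hd : (G.edist hG p z).toReal = Real.sqrt (G.val p u u) := by
      rw [← huz, hΦ, hpol, ENNReal.toReal_ofReal (Real.sqrt_nonneg _)]
    have hr := hrev p u
    rw [← hΦ] at hr
    have hEq : (Ex (Φ u)).symm p = (Ex z).symm p := by rw [huz]
    -- `Y z = c u • d(Ex p)_u u` as vectors of `ℝ⁵`
    have hYz : (Y z : EuclideanSpace ℝ (Fin 5)) = c u • (mfderiv (𝓡 5) (𝓡 5) Φ u u :
        EuclideanSpace ℝ (Fin 5)) := by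
      show mfderiv (𝓡 5) (𝓡 5) Φ u (c u • u) = c u • mfderiv (𝓡 5) (𝓡 5) Φ u u
      exact ContinuousLinearMap.map_smul _ _ _
    have hM : (mfderiv (𝓡 5) (𝓡 5) Φ u u : EuclideanSpace ℝ (Fin 5)) = -((Ex z).symm p) := by
      rw [← hEq, hr, neg_neg]
    rw [hYz, hM, hd]
    show (Real.sqrt (G.val p u u))⁻¹ • (-((Ex z).symm p)) =
      -((Real.sqrt (G.val p u u))⁻¹ • (Ex z).symm p)
    exact smul_neg _ _
  · -- ### along `Ex p`
    intro u
    show mfderiv (𝓡 5) (𝓡 5) Φ (Φ.symm (Φ u)) (g (Φ.symm (Φ u))) = _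
    rw [Φ.symm_apply_apply]


set_option maxHeartbeats 1600000 in
/-- **E1 helper 3 (Lyapunov growth of the core distance along a gradient-like field).** In the
polar package (`d_G(p, Ex p u) = |u|_{G_p}`, Gauss lemma, reversal), let `K` be compact,
`f = ⨅_{k ∈ K} d_G(·, k)`, and let the field `X` satisfy, at every `z` with `f z ≥ a/2`, for every
`k ∈ K` with `d(z,k) ≤ f z + η`, the margin `μ · d(z,k) ≤ −G_z((Ex z)⁻¹ k, X z)`. Then for every
integral curve `γ` of `X` on `[t₁, t₂]` with `f(γ t₁) ≥ a`:
`f(γ t₁) + μ (t₂ − t₁) ≤ f(γ t₂)` (Danskin's one-sided bound for `f = min_k d_k` via helper 2,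
then real induction). [cite: GroveShiohama1977, §1; Petersen2016, §12.1 Lemma 12.1.4] -/
theorem helper_gradientLikeField_3 :
    ∀ (W : Type) [TopologicalSpace W] [T2Space W] [SecondCountableTopology W]
    [ChartedSpace (EuclideanSpace ℝ (Fin 5)) W] [IsManifold (𝓡 5) ∞ W]
    (G : Literature.Geometry.Lorentzian.PseudoRiemannianMetric (𝓡 5) ∞ (EuclideanSpace ℝ (Fin 5))
      (TangentSpace (𝓡 5) : W → Type _)) (hG : G.IsRiemannian)
    (Ex : W → (EuclideanSpace ℝ (Fin 5) ≃ₘ^∞⟮𝓡 5, 𝓡 5⟯ W)),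
    (∀ (p : W) (u : EuclideanSpace ℝ (Fin 5)),
      G.edist hG p (Ex p u) = ENNReal.ofReal (Real.sqrt (G.val p u u))) →
    (∀ (p : W) (u w : EuclideanSpace ℝ (Fin 5)),
      G.val (Ex p u) (mfderiv (𝓡 5) (𝓡 5) (Ex p) u u) (mfderiv (𝓡 5) (𝓡 5) (Ex p) u w) =
        G.val p u w) →
    (∀ (p : W) (u : EuclideanSpace ℝ (Fin 5)),
      (Ex (Ex p u)).symm p = -(mfderiv (𝓡 5) (𝓡 5) (Ex p) u u)) →
    ∀ (K : Set W), IsCompact K → ∀ (X : Π y : W, TangentSpace (𝓡 5) y) (a μ η : ℝ),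
      0 < a → 0 < μ → 0 < η →
      (∀ z : W, ENNReal.ofReal (a / 2) ≤ ⨅ k ∈ K, G.edist hG z k → ∀ k ∈ K,
        G.edist hG z k ≤ (⨅ k' ∈ K, G.edist hG z k') + ENNReal.ofReal η →
        μ * (G.edist hG z k).toReal ≤ -(G.val z ((Ex z).symm k) (X z))) →
      ∀ (γ : ℝ → W) (t₁ t₂ : ℝ), t₁ ≤ t₂ → IsMIntegralCurveOn γ X (Icc t₁ t₂) →
        ENNReal.ofReal a ≤ ⨅ k ∈ K, G.edist hG (γ t₁) k →
        (⨅ k ∈ K, G.edist hG (γ t₁) k) + ENNReal.ofReal (μ * (t₂ - t₁)) ≤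
          ⨅ k ∈ K, G.edist hG (γ t₂) k := by
  intro W _ _ _ _ _ G hG Ex hpol hgauss hrev K hK X a μ η ha hμ hη hcon γ t₁ t₂ ht hγ hfa
  -- empty core: `f ≡ ⊤`
  rcases K.eq_empty_or_nonempty with hKe | hKne
  · subst hKe
    simp
  -- the distance structure of `(W, G)` and `f = infEDist(·, K)`
  letI := G.riemannianBundle hG
  haveI := G.isContinuousRiemannianBundle hG
  haveI : LocallyCompactSpace W := ChartedSpace.locallyCompactSpace (EuclideanSpace ℝ (Fin 5)) W
  letI : PseudoEMetricSpace W := .ofRiemannianMetric (𝓡 5) W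
  have hed : ∀ y z : W, G.edist hG y z = edist y z := fun _ _ ↦ rfl
  set f : W → ℝ≥0∞ := fun y ↦ ⨅ k ∈ K, G.edist hG y k with hf
  have hfE : ∀ y : W, f y = Metric.infEDist y K := fun _ ↦ rfl
  -- all distances are finite (polar package), hence so is `f`
  have hfin : ∀ y z : W, edist y z ≠ ⊤ := by
    intro y z
    rw [← hed, ← (Ex y).apply_symm_apply z, hpol]
    exact ENNReal.ofReal_ne_top
  obtain ⟨k₀, hk₀⟩ := hKne
  have hffin : ∀ y : W, f y ≠ ⊤ := fun y ↦
    ne_top_of_le_ne_top (hfin y k₀) (by rw [hfE]; exact Metric.infEDist_le_edist_of_mem hk₀)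
  -- `f` is `1`-Lipschitz
  have hflip : ∀ y z : W, f y ≤ f z + edist y z := fun y z ↦ by
    rw [hfE, hfE]; exact Metric.infEDist_le_infEDist_add_edist
  -- real-valued versions
  set φ : ℝ → ℝ := fun t ↦ (f (γ t)).toReal with hφ
  have hφf : ∀ t, f (γ t) = ENNReal.ofReal (φ t) := fun t ↦ (ENNReal.ofReal_toReal (hffin _)).symm
  have hφnn : ∀ t, 0 ≤ φ t := fun t ↦ ENNReal.toReal_nonneg
  -- continuity of `γ` and of `φ` on `[t₁, t₂]`
  have hγc : ContinuousOn γ (Icc t₁ t₂) := hγ.continuousOn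
  have hfc : Continuous f := by
    have : Continuous fun y : W ↦ Metric.infEDist y K := Metric.continuous_infEDist
    exact this
  have hφc : ContinuousOn φ (Icc t₁ t₂) :=
    ENNReal.continuousOn_toReal.comp (hfc.comp_continuousOn hγc) fun t _ ↦ hffin _
  have hφa : a ≤ φ t₁ := by
    have h := hfa
    rw [show (⨅ k ∈ K, G.edist hG (γ t₁) k) = f (γ t₁) from rfl, hφf] at h
    exact (ENNReal.ofReal_le_ofReal_iff (hφnn _)).1 h
  -- conversions between `edist` and reals
  have htoR : ∀ {x : ℝ≥0∞} {r : ℝ}, x ≠ ⊤ → 0 ≤ r → (x ≤ ENNReal.ofReal r ↔ x.toReal ≤ r) :=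
    fun hx hr ↦ by rw [← ENNReal.ofReal_toReal hx, ENNReal.ofReal_le_ofReal_iff hr,
      ENNReal.toReal_ofReal ENNReal.toReal_nonneg]
  -- ### the inductive set `S = {t | φ t₁ + μ (t - t₁) ≤ φ t}` contains `[t₁, t₂]`
  set Sset : Set ℝ := {t | φ t₁ + μ * (t - t₁) ≤ φ t} with hS
  have hmain : Icc t₁ t₂ ⊆ Sset := by
    apply IsClosed.Icc_subset_of_forall_mem_nhdsWithin
    · -- `S ∩ [t₁, t₂]` is closed
      have hrew : Sset ∩ Icc t₁ t₂ =
          Icc t₁ t₂ ∩ (fun t ↦ φ t - (φ t₁ + μ * (t - t₁))) ⁻¹' Ici 0 := by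
        ext t
        simp only [hS, mem_inter_iff, mem_setOf_eq, mem_preimage, mem_Ici, sub_nonneg]
        tauto
      rw [hrew]
      refine ContinuousOn.preimage_isClosed_of_isClosed ?_ isClosed_Icc isClosed_Ici
      exact hφc.sub (continuousOn_const.add (continuousOn_const.mul
        (continuousOn_id.sub continuousOn_const)))
    · show φ t₁ + μ * (t₁ - t₁) ≤ φ t₁
      simp
    · rintro t ⟨htS, ht1, ht2⟩
      have hφt : a ≤ φ t := by
        have h1 : φ t₁ + μ * (t - t₁) ≤ φ t := htS
        nlinarith [hμ.le, ht1]
      -- continuity of `γ` at `t`: `γ s` is `η'/4`-close to `γ t` for `s ∈ [t, t + h₀]`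
      set η' : ℝ := min η a with hη'
      have hη'0 : 0 < η' := lt_min hη ha
      have hη'η : η' ≤ η := min_le_left _ _
      have hη'a : η' ≤ a := min_le_right _ _
      have hε : (0 : ℝ≥0∞) < ENNReal.ofReal (η' / 4) := ENNReal.ofReal_pos.2 (by linarith)
      have hct : ContinuousWithinAt γ (Icc t₁ t₂) t := hγc t ⟨ht1, ht2.le⟩
      have hpre := hct.preimage_mem_nhdsWithin (Metric.eball_mem_nhds (γ t) hε)
      obtain ⟨U, hU, hUsub⟩ := mem_nhdsWithin_iff_exists_mem_nhds_inter.1 hpre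
      obtain ⟨ρ, hρ, hball⟩ := Metric.mem_nhds_iff.1 hU
      set h₀ : ℝ := min (ρ / 2) (t₂ - t) with hh₀
      have hh₀0 : 0 < h₀ := lt_min (by linarith) (by linarith)
      have hh₀ρ : h₀ ≤ ρ / 2 := min_le_left _ _
      have hh₀t : h₀ ≤ t₂ - t := min_le_right _ _
      have hclose : ∀ s ∈ Icc t (t + h₀), edist (γ s) (γ t) < ENNReal.ofReal (η' / 4) := by
        intro s hs
        have hsI : s ∈ Icc t₁ t₂ := ⟨ht1.trans hs.1, by linarith [hs.2]⟩
        have hsU : s ∈ U := hball (by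
          rw [Metric.mem_ball, Real.dist_eq, abs_lt]
          constructor <;> linarith [hs.1, hs.2])
        exact hUsub ⟨hsU, hsI⟩
      -- ### the local growth `φ (t + h) ≥ φ t + μ h` for `0 < h ≤ h₀`
      have hstep : ∀ h ∈ Ioc (0 : ℝ) h₀, φ t + μ * h ≤ φ (t + h) := by
        intro h hh
        have hthI : Icc t (t + h) ⊆ Icc t₁ t₂ := Icc_subset_Icc ht1 (by linarith [hh.2])
        -- a nearest point `kh` of `z = γ (t + h)`
        obtain ⟨kh, hkhK, hkh⟩ := hK.exists_infEDist_eq_edist ⟨k₀, hk₀⟩ (γ (t + h))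
        have hfz : f (γ (t + h)) = edist (γ (t + h)) kh := hkh
        -- along `[t, t + h]`: `γ s` stays `η'/2`-close to `γ (t + h)`
        have hclose2 : ∀ s ∈ Icc t (t + h),
            edist (γ s) (γ (t + h)) < ENNReal.ofReal (η' / 2) := by
          intro s hs
          have h1 := hclose s ⟨hs.1, hs.2.trans (by linarith [hh.2])⟩
          have h2 := hclose (t + h) ⟨by linarith [hh.1], by linarith [hh.2]⟩
          calc edist (γ s) (γ (t + h)) ≤ edist (γ s) (γ t) + edist (γ t) (γ (t + h)) :=
                edist_triangle _ _ _
            _ < ENNReal.ofReal (η' / 4) + ENNReal.ofReal (η' / 4) := by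
                rw [edist_comm (γ t)]
                exact ENNReal.add_lt_add h1 h2
            _ = ENNReal.ofReal (η' / 2) := by
                rw [← ENNReal.ofReal_add (by linarith) (by linarith)]; ring_nf
        -- (A) `f (γ s) ≥ a/2` on `[t, t + h]`
        have hA : ∀ s ∈ Icc t (t + h), ENNReal.ofReal (a / 2) ≤ f (γ s) := by
          intro s hs
          have h1 := hclose s ⟨hs.1, hs.2.trans (by linarith [hh.2])⟩
          have h2 : f (γ t) ≤ f (γ s) + edist (γ t) (γ s) := hflip _ _
          have h3 : (edist (γ t) (γ s)).toReal < η' / 4 := by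
            rw [edist_comm] at h1
            have := (ENNReal.toReal_lt_toReal (hfin _ _) ENNReal.ofReal_ne_top).2 h1
            rwa [ENNReal.toReal_ofReal (by linarith)] at this
          have h4 : φ t ≤ φ s + (edist (γ t) (γ s)).toReal := by
            have := ENNReal.toReal_mono (ENNReal.add_ne_top.2 ⟨hffin _, hfin _ _⟩) h2
            rwa [ENNReal.toReal_add (hffin _) (hfin _ _)] at this
          rw [hφf]
          exact ENNReal.ofReal_le_ofReal (by linarith)
        -- (B) `kh` is `η`-almost nearest for every `γ s`, `s ∈ [t, t + h]`
        have hB : ∀ s ∈ Icc t (t + h), edist (γ s) kh ≤ f (γ s) + ENNReal.ofReal η := by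
          intro s hs
          have h1 := hclose2 s hs
          calc edist (γ s) kh ≤ edist (γ s) (γ (t + h)) + edist (γ (t + h)) kh :=
                edist_triangle _ _ _
            _ = edist (γ s) (γ (t + h)) + f (γ (t + h)) := by rw [hfz]
            _ ≤ edist (γ s) (γ (t + h)) + (f (γ s) + edist (γ (t + h)) (γ s)) :=
                add_le_add le_rfl (hflip _ _)
            _ ≤ ENNReal.ofReal (η' / 2) + (f (γ s) + ENNReal.ofReal (η' / 2)) := by
                apply add_le_add h1.le (add_le_add le_rfl _)
                rw [edist_comm]; exact h1.le
            _ = f (γ s) + ENNReal.ofReal η' := by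
                rw [add_comm, add_assoc, ← ENNReal.ofReal_add (by linarith) (by linarith)]
                ring_nf
            _ ≤ f (γ s) + ENNReal.ofReal η := add_le_add le_rfl (ENNReal.ofReal_le_ofReal hη'η)
        -- (C) `γ s ≠ kh` and `d s := d(kh, γ s) ≥ a/2`
        have hdpos : ∀ s ∈ Icc t (t + h), a / 2 ≤ (edist kh (γ s)).toReal := by
          intro s hs
          have h1 : f (γ s) ≤ edist (γ s) kh := by
            rw [hfE]; exact Metric.infEDist_le_edist_of_mem hkhK
          have h2 := (hA s hs).trans h1
          rw [edist_comm] at h2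
          exact (ENNReal.ofReal_le_iff_le_toReal (hfin kh (γ s))).1 h2
        have hC : ∀ s ∈ Icc t (t + h), γ s ≠ kh := by
          intro s hs heq
          have h1 := hdpos s hs
          rw [heq, edist_self, ENNReal.toReal_zero] at h1
          linarith
        -- (D) the derivative of `r ↦ d(kh, γ r)` within `[t₁, t₂]` is `≥ μ` on `[t, t + h]`
        have hD : ∀ s ∈ Icc t (t + h), HasDerivWithinAt (fun r ↦ (G.edist hG kh (γ r)).toReal)
            (-(G.val (γ s) ((Ex (γ s)).symm kh) (X (γ s))) / (G.edist hG kh (γ s)).toReal)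
            (Icc t₁ t₂) s ∧
            μ ≤ -(G.val (γ s) ((Ex (γ s)).symm kh) (X (γ s))) / (G.edist hG kh (γ s)).toReal := by
          intro s hs
          have hsI : s ∈ Icc t₁ t₂ := hthI hs
          refine ⟨helper_gradientLikeField_2 W G hG Ex hpol hgauss hrev kh γ (Icc t₁ t₂) s
            (X (γ s)) (hγ s hsI) (hC s hs), ?_⟩
          have hcs := hcon (γ s) (hA s hs) kh hkhK (hB s hs)
          have hd : 0 < (G.edist hG kh (γ s)).toReal := by
            rw [hed]; linarith [hdpos s hs]
          rw [le_div_iff₀ hd]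
          rw [hed, edist_comm, ← hed]
          exact hcs
        -- monotonicity of `g r = d(kh, γ r) - μ r` on `[t, t + h]`
        have hmono : MonotoneOn (fun r ↦ (G.edist hG kh (γ r)).toReal - r * μ) (Icc t (t + h)) := by
          refine monotoneOn_of_hasDerivWithinAt_nonneg (convex_Icc _ _)
            (f' := fun r ↦ -(G.val (γ r) ((Ex (γ r)).symm kh) (X (γ r))) /
              (G.edist hG kh (γ r)).toReal - 1 * μ) ?_ ?_ ?_
          · intro r hr
            exact ((hD r hr).1.continuousWithinAt.mono hthI).sub
              ((continuousWithinAt_id.mul continuousWithinAt_const))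
          · intro r hr
            rw [interior_Icc] at hr ⊢
            have hr' : r ∈ Icc t (t + h) := Ioo_subset_Icc_self hr
            exact ((hD r hr').1.mono ((Ioo_subset_Icc_self).trans hthI)).sub
              ((hasDerivWithinAt_id r _).mul_const μ)
          · intro r hr
            rw [interior_Icc] at hr
            have := (hD r (Ioo_subset_Icc_self hr)).2
            linarith
        have hg := hmono ⟨le_rfl, by linarith [hh.1]⟩ ⟨by linarith [hh.1], le_rfl⟩
          (by linarith [hh.1])
        -- Danskin: `φ (t + h) - φ t ≥ d(kh, γ (t + h)) - d(kh, γ t)`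
        have hφth : φ (t + h) = (G.edist hG kh (γ (t + h))).toReal := by
          show (f (γ (t + h))).toReal = _
          rw [hfz, hed, edist_comm]
        have hφt' : φ t ≤ (G.edist hG kh (γ t)).toReal := by
          have h1 : f (γ t) ≤ edist (γ t) kh := by
            rw [hfE]; exact Metric.infEDist_le_edist_of_mem hkhK
          rw [hed, edist_comm]
          exact ENNReal.toReal_mono (hfin _ _) h1
        have hg' : (G.edist hG kh (γ t)).toReal - t * μ ≤
            (G.edist hG kh (γ (t + h))).toReal - (t + h) * μ := hg
        rw [hφth]
        nlinarith [hg', hφt']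
      -- ### hence `S ∈ 𝓝[>] t`
      have hsub : Ioc t (t + h₀) ⊆ Sset := by
        intro s hs
        have h1 := hstep (s - t) ⟨by linarith [hs.1], by linarith [hs.2]⟩
        have h2 : φ t₁ + μ * (t - t₁) ≤ φ t := htS
        show φ t₁ + μ * (s - t₁) ≤ φ s
        rw [show t + (s - t) = s by ring] at h1
        nlinarith [h1, h2]
      exact mem_of_superset (Ioc_mem_nhdsGT (by linarith)) hsub
  -- ### conclusion at `t₂`
  have h2 : φ t₁ + μ * (t₂ - t₁) ≤ φ t₂ := hmain ⟨ht, le_rfl⟩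
  show f (γ t₁) + ENNReal.ofReal (μ * (t₂ - t₁)) ≤ f (γ t₂)
  rw [hφf t₁, hφf t₂, ← ENNReal.ofReal_add (hφnn _) (by nlinarith [hμ.le, ht])]
  exact ENNReal.ofReal_le_ofReal h2


section LawOfCosines

variable {W : Type} [TopologicalSpace W] [T2Space W] [SecondCountableTopology W]
  [ChartedSpace (EuclideanSpace ℝ (Fin 5)) W] [IsManifold (𝓡 5) ∞ W]
  (G : PseudoRiemannianMetric (𝓡 5) ∞ (EuclideanSpace ℝ (Fin 5)) (TangentSpace (𝓡 5) : W → Type _))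
  (hG : G.IsRiemannian) (Ex : W → (EuclideanSpace ℝ (Fin 5) ≃ₘ^∞⟮𝓡 5, 𝓡 5⟯ W))
  (hpol : ∀ (p : W) (u : EuclideanSpace ℝ (Fin 5)),
    G.edist hG p (Ex p u) = ENNReal.ofReal (Real.sqrt (G.val p u u)))
  (hlip : ∀ (y p q : W), ENNReal.ofReal (Real.sqrt
      (G.val y ((Ex y).symm p - (Ex y).symm q) ((Ex y).symm p - (Ex y).symm q))) ≤
    G.edist hG p q)

omit [T2Space W] [SecondCountableTopology W] in
include hpol in
/-- In the polar package, `d_G(z, p) = |(Ex z)⁻¹ p|_{G_z}`: the real distance is the square root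
of `G_z(V_p, V_p)`, `V_p = (Ex z)⁻¹ p`. [folklore] -/
theorem toReal_edist_eq_sqrt_val_symm (z p : W) :
    (G.edist hG z p).toReal = Real.sqrt (G.val z ((Ex z).symm p) ((Ex z).symm p)) := by
  have h := hpol z ((Ex z).symm p)
  rw [(Ex z).apply_symm_apply] at h
  rw [h, ENNReal.toReal_ofReal (Real.sqrt_nonneg _)]

omit [T2Space W] [SecondCountableTopology W] in
include hpol in
/-- In the polar package all distances are finite. [folklore] -/
theorem edist_ne_top_of_polar (z p : W) : G.edist hG z p ≠ ⊤ := by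
  have h := hpol z ((Ex z).symm p)
  rw [(Ex z).apply_symm_apply] at h
  rw [h]
  exact ENNReal.ofReal_ne_top

omit [T2Space W] [SecondCountableTopology W] in
include hpol hlip in
/-- **Comparison law of cosines (CAT(0) form).** In the polar package with the `1`-Lipschitz
inverse, `G_z(V_p, V_q) ≥ (d(z,p)² + d(z,q)² − d(p,q)²)/2` for `V_p = (Ex z)⁻¹ p`,
`V_q = (Ex z)⁻¹ q` (polarisation of `|V_p − V_q|²_{G_z} ≤ d(p,q)²`).
[cite: BridsonHaefliger1999, Ch. II.1, Prop. 1.7 (4)] -/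
theorem val_symm_symm_ge (z p q : W) :
    ((G.edist hG z p).toReal ^ 2 + (G.edist hG z q).toReal ^ 2 - (G.edist hG p q).toReal ^ 2) / 2
      ≤ G.val z ((Ex z).symm p) ((Ex z).symm q) := by
  set B : EuclideanSpace ℝ (Fin 5) →L[ℝ] EuclideanSpace ℝ (Fin 5) →L[ℝ] ℝ := G.val z with hB
  have hBv : ∀ v w : EuclideanSpace ℝ (Fin 5), B v w = G.val z v w := fun _ _ ↦ rfl
  have hBs : ∀ v w : EuclideanSpace ℝ (Fin 5), B v w = B w v := fun v w ↦ G.symm z v w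
  have hnn : ∀ v : EuclideanSpace ℝ (Fin 5), 0 ≤ B v v := fun v ↦ by
    by_cases hv : v = 0
    · subst hv; simp
    · exact (hG z v hv).le
  set Vp : EuclideanSpace ℝ (Fin 5) := (Ex z).symm p
  set Vq : EuclideanSpace ℝ (Fin 5) := (Ex z).symm q
  -- the three squared lengths
  have hp2 : (G.edist hG z p).toReal ^ 2 = B Vp Vp := by
    rw [toReal_edist_eq_sqrt_val_symm G hG Ex hpol z p]
    exact Real.sq_sqrt (hnn Vp)
  have hq2 : (G.edist hG z q).toReal ^ 2 = B Vq Vq := by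
    rw [toReal_edist_eq_sqrt_val_symm G hG Ex hpol z q]
    exact Real.sq_sqrt (hnn Vq)
  have hpq : B (Vp - Vq) (Vp - Vq) ≤ (G.edist hG p q).toReal ^ 2 := by
    have h1 := hlip z p q
    have h2 : Real.sqrt (B (Vp - Vq) (Vp - Vq)) ≤ (G.edist hG p q).toReal :=
      (ENNReal.ofReal_le_iff_le_toReal (edist_ne_top_of_polar G hG Ex hpol p q)).1 h1
    have h3 := pow_le_pow_left₀ (Real.sqrt_nonneg _) h2 2
    rwa [Real.sq_sqrt (hnn _)] at h3
  -- polarisation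
  have hpolar : B (Vp - Vq) (Vp - Vq) = B Vp Vp - 2 * B Vp Vq + B Vq Vq := by
    rw [B.map_sub₂, map_sub, map_sub, hBs Vq Vp]
    ring
  rw [← hBv, hp2, hq2]
  linarith

end LawOfCosines

set_option maxHeartbeats 1600000 in
/-- **E1 helper 5 (far field: the radial direction is regular).** In the polar package with the
`1`-Lipschitz inverse: if `d(o, k) ≤ D` (`D ≥ 0`) and `d(o, z) ≥ 2D`, then
`½ d(o,z) d(z,k) ≤ G_z((Ex z)⁻¹ o, (Ex z)⁻¹ k)` (comparison law of cosines: with `r = d(o,z)`,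
`d = d(z,k)`, `G_z(V_o, V_k) ≥ (r² + d² − D²)/2 ≥ r d/2`).
[cite: GroveShiohama1977, §1; Petersen2016, §12.1] -/
theorem helper_gradientLikeField_5 :
    ∀ (W : Type) [TopologicalSpace W] [T2Space W] [SecondCountableTopology W]
    [ChartedSpace (EuclideanSpace ℝ (Fin 5)) W] [IsManifold (𝓡 5) ∞ W]
    (G : Literature.Geometry.Lorentzian.PseudoRiemannianMetric (𝓡 5) ∞ (EuclideanSpace ℝ (Fin 5))
      (TangentSpace (𝓡 5) : W → Type _)) (hG : G.IsRiemannian)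
    (Ex : W → (EuclideanSpace ℝ (Fin 5) ≃ₘ^∞⟮𝓡 5, 𝓡 5⟯ W)),
    (∀ (p : W) (u : EuclideanSpace ℝ (Fin 5)),
      G.edist hG p (Ex p u) = ENNReal.ofReal (Real.sqrt (G.val p u u))) →
    (∀ (y p q : W), ENNReal.ofReal (Real.sqrt
        (G.val y ((Ex y).symm p - (Ex y).symm q) ((Ex y).symm p - (Ex y).symm q))) ≤
      G.edist hG p q) →
    ∀ (o z k : W) (D : ℝ), 0 ≤ D → G.edist hG o k ≤ ENNReal.ofReal D →
      ENNReal.ofReal (2 * D) ≤ G.edist hG o z →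
      1 / 2 * (G.edist hG o z).toReal * (G.edist hG z k).toReal ≤
        G.val z ((Ex z).symm o) ((Ex z).symm k) := by
  intro W _ _ _ _ _ G hG Ex hpol hlip o z k D hD hok hoz
  have hcos := val_symm_symm_ge G hG Ex hpol hlip z o k
  have hfin := edist_ne_top_of_polar G hG Ex hpol
  set r : ℝ := (G.edist hG o z).toReal with hr
  set d : ℝ := (G.edist hG z k).toReal with hd
  have hzo : (G.edist hG z o).toReal = r := by rw [hr, G.edist_comm hG]
  have hr0 : 2 * D ≤ r := (ENNReal.ofReal_le_iff_le_toReal (hfin o z)).1 hoz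
  have hd0 : 0 ≤ d := ENNReal.toReal_nonneg
  have hDk : (G.edist hG o k).toReal ≤ D := by
    have := ENNReal.toReal_mono ENNReal.ofReal_ne_top hok
    rwa [ENNReal.toReal_ofReal hD] at this
  have hDk0 : 0 ≤ (G.edist hG o k).toReal := ENNReal.toReal_nonneg
  rw [hzo] at hcos
  have h1 : (G.edist hG o k).toReal ^ 2 ≤ D ^ 2 := pow_le_pow_left₀ hDk0 hDk 2
  nlinarith [hcos, h1, sq_nonneg (d - r / 2)]

set_option maxHeartbeats 1600000 in
/-- **E1 helper 4 (near field: the direction away from a nearest point is regular, with margin,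
for all almost-nearest points, locally uniformly).** In the polar package with the `1`-Lipschitz
inverse, let `K` be compact with the `ρ`-spread property (nearest points of `y ∉ K` are
`ρ d(y,K)`-close) and let `0 < μ`, `2μ < 2 − (ρ₊)²`. If `d(z₀, K) > 0` and `k₁ ∈ K` is a nearest
point of `z₀`, there are an open `O ∋ z₀` and `η₀ > 0` such that for all `z ∈ O`: `z ≠ k₁`, and
for every `k ∈ K` with `d(z,k) ≤ d(z,K) + η₀`, `μ d(z,k₁) d(z,k) ≤ G_z((Ex z)⁻¹ k₁, (Ex z)⁻¹ k)`
(at `z₀` and an exact nearest `k` the law of cosines and the spread give the margin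
`d² (2 − ρ₊² − 2μ) > 0`; compactness of `K` and continuity propagate it).
[cite: GroveShiohama1977, §1; Petersen2016, §12.1 Prop. 12.1.2] -/
theorem helper_gradientLikeField_4 :
    ∀ (W : Type) [TopologicalSpace W] [T2Space W] [SecondCountableTopology W]
    [ChartedSpace (EuclideanSpace ℝ (Fin 5)) W] [IsManifold (𝓡 5) ∞ W]
    (G : Literature.Geometry.Lorentzian.PseudoRiemannianMetric (𝓡 5) ∞ (EuclideanSpace ℝ (Fin 5))
      (TangentSpace (𝓡 5) : W → Type _)) (hG : G.IsRiemannian)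
    (Ex : W → (EuclideanSpace ℝ (Fin 5) ≃ₘ^∞⟮𝓡 5, 𝓡 5⟯ W)),
    (∀ (p : W) (u : EuclideanSpace ℝ (Fin 5)),
      G.edist hG p (Ex p u) = ENNReal.ofReal (Real.sqrt (G.val p u u))) →
    (∀ (y p q : W), ENNReal.ofReal (Real.sqrt
        (G.val y ((Ex y).symm p - (Ex y).symm q) ((Ex y).symm p - (Ex y).symm q))) ≤
      G.edist hG p q) →
    ∀ (K : Set W), IsCompact K → ∀ (ρ μ : ℝ), 0 < μ → 2 * μ < 2 - (max ρ 0) ^ 2 →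
      (∀ y ∈ Kᶜ, ∀ k₁ ∈ K, ∀ k₂ ∈ K,
        G.edist hG y k₁ = ⨅ k ∈ K, G.edist hG y k → G.edist hG y k₂ = ⨅ k ∈ K, G.edist hG y k →
        G.edist hG k₁ k₂ ≤ ENNReal.ofReal ρ * ⨅ k ∈ K, G.edist hG y k) →
      ∀ (z₀ k₁ : W), k₁ ∈ K → 0 < ⨅ k ∈ K, G.edist hG z₀ k →
        G.edist hG z₀ k₁ = ⨅ k ∈ K, G.edist hG z₀ k →
        ∃ O : Set W, IsOpen O ∧ z₀ ∈ O ∧ ∃ η₀ : ℝ, 0 < η₀ ∧ ∀ z ∈ O, z ≠ k₁ ∧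
          ∀ k ∈ K, G.edist hG z k ≤ (⨅ k' ∈ K, G.edist hG z k') + ENNReal.ofReal η₀ →
            μ * (G.edist hG z k₁).toReal * (G.edist hG z k).toReal ≤
              G.val z ((Ex z).symm k₁) ((Ex z).symm k) := by
  intro W _ _ _ _ _ G hG Ex hpol hlip K hK ρ μ hμ hμρ hspread z₀ k₁ hk₁ hf0 hnear
  have hcos := val_symm_symm_ge G hG Ex hpol hlip
  have hfinG := edist_ne_top_of_polar G hG Ex hpol
  -- the distance structure of `(W, G)`; `f = infEDist(·, K)`
  letI := G.riemannianBundle hG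
  haveI := G.isContinuousRiemannianBundle hG
  haveI : LocallyCompactSpace W := ChartedSpace.locallyCompactSpace (EuclideanSpace ℝ (Fin 5)) W
  letI : PseudoEMetricSpace W := .ofRiemannianMetric (𝓡 5) W
  have hed : ∀ y z : W, G.edist hG y z = edist y z := fun _ _ ↦ rfl
  set f : W → ℝ≥0∞ := fun y ↦ ⨅ k ∈ K, G.edist hG y k with hf
  have hfE : ∀ y : W, f y = Metric.infEDist y K := fun _ ↦ rfl
  have hfin : ∀ y z : W, edist y z ≠ ⊤ := fun y z ↦ hfinG y z
  have hffin : ∀ y : W, f y ≠ ⊤ := fun y ↦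
    ne_top_of_le_ne_top (hfin y k₁) (by rw [hfE]; exact Metric.infEDist_le_edist_of_mem hk₁)
  have hfle : ∀ (y : W), ∀ k ∈ K, f y ≤ edist y k := fun y k hk ↦ by
    rw [hfE]; exact Metric.infEDist_le_edist_of_mem hk
  -- real versions and their continuity
  set dR : W → W → ℝ := fun y z ↦ (edist y z).toReal with hdR
  set fR : W → ℝ := fun y ↦ (f y).toReal with hfR
  have hdRc : Continuous fun p : W × W ↦ dR p.1 p.2 :=
    ENNReal.continuousOn_toReal.comp_continuous continuous_edist fun p ↦ hfin p.1 p.2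
  have hfc : Continuous f := by
    have : Continuous fun y : W ↦ Metric.infEDist y K := Metric.continuous_infEDist
    exact this
  have hfRc : Continuous fR := ENNReal.continuousOn_toReal.comp_continuous hfc fun y ↦ hffin y
  -- data at `z₀`
  set T : ℝ := fR z₀ with hT
  have hT0 : 0 < T := ENNReal.toReal_pos hf0.ne' (hffin z₀)
  have hz₀K : z₀ ∈ Kᶜ := by
    intro hz
    have : f z₀ ≤ edist z₀ z₀ := hfle z₀ z₀ hz
    rw [edist_self, nonpos_iff_eq_zero] at this
    exact hf0.ne' this
  have hd1 : dR z₀ k₁ = T := by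
    show (edist z₀ k₁).toReal = (f z₀).toReal
    rw [← hed, hnear]
  set ρp : ℝ := max ρ 0 with hρp
  have hρp0 : 0 ≤ ρp := le_max_right _ _
  -- the margin function `Θ` and the gap function `Λ = max Θ (d - f)`
  set Θ : W → W → ℝ := fun z k ↦
    dR z k₁ ^ 2 + dR z k ^ 2 - dR k₁ k ^ 2 - 2 * μ * dR z k₁ * dR z k with hΘ
  set Λ : W → W → ℝ := fun z k ↦ max (Θ z k) (dR z k - fR z) with hΛ
  have hΛc : Continuous fun p : W × W ↦ Λ p.1 p.2 := by
    have h1 : Continuous fun p : W × W ↦ dR p.1 k₁ :=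
      hdRc.comp (continuous_fst.prodMk continuous_const)
    have h2 : Continuous fun p : W × W ↦ dR k₁ p.2 :=
      hdRc.comp (continuous_const.prodMk continuous_snd)
    have h3 : Continuous fun p : W × W ↦ fR p.1 := hfRc.comp continuous_fst
    exact ((((h1.pow 2).add (hdRc.pow 2)).sub (h2.pow 2)).sub
      (((continuous_const.mul h1).mul hdRc))).max (hdRc.sub h3)
  -- ### at `z₀`: `Λ(z₀, k) > 0` for every `k ∈ K`
  have hpos : ∀ k ∈ K, 0 < Λ z₀ k := by
    intro k hk
    have hge : fR z₀ ≤ dR z₀ k := ENNReal.toReal_mono (hfin _ _) (hfle z₀ k hk)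
    rcases hge.lt_or_eq with hlt | heq
    · exact lt_max_of_lt_right (by linarith)
    · -- `k` is an exact nearest point: spread + law of cosines
      have hkn : G.edist hG z₀ k = ⨅ k' ∈ K, G.edist hG z₀ k' := by
        show edist z₀ k = f z₀
        exact (ENNReal.toReal_eq_toReal_iff' (hfin _ _) (hffin _)).1 heq.symm
      have hsp := hspread z₀ hz₀K k₁ hk₁ k hk hnear hkn
      have hsp' : dR k₁ k ≤ ρp * T := by
        have h1 := ENNReal.toReal_mono (ENNReal.mul_ne_top ENNReal.ofReal_ne_top (hffin z₀)) hsp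
        rw [ENNReal.toReal_mul, ENNReal.toReal_ofReal'] at h1
        exact h1
      have hdk : dR z₀ k = T := heq.symm
      have hΘ0 : 0 < Θ z₀ k := by
        show 0 < dR z₀ k₁ ^ 2 + dR z₀ k ^ 2 - dR k₁ k ^ 2 - 2 * μ * dR z₀ k₁ * dR z₀ k
        rw [hd1, hdk]
        have h1 : dR k₁ k ^ 2 ≤ (ρp * T) ^ 2 := pow_le_pow_left₀ ENNReal.toReal_nonneg hsp' 2
        have h2 : 0 < T ^ 2 * (2 - ρp ^ 2 - 2 * μ) := mul_pos (pow_pos hT0 2) (by linarith)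
        nlinarith [h1, h2]
      exact lt_max_of_lt_left hΘ0
  -- a uniform positive lower bound `m` on the compact `K`
  obtain ⟨kmin, hkminK, hkmin⟩ := hK.exists_isMinOn ⟨k₁, hk₁⟩
    ((hΛc.comp (continuous_const.prodMk continuous_id)).continuousOn :
      ContinuousOn (fun k : W ↦ Λ z₀ k) K)
  set m : ℝ := Λ z₀ kmin with hm
  have hm0 : 0 < m := hpos kmin hkminK
  have hmle : ∀ k ∈ K, m ≤ Λ z₀ k := fun k hk ↦ hkmin hk
  -- ### propagate to a neighbourhood of `z₀`, uniformly in `k ∈ K`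
  have hev : ∀ᶠ z in 𝓝 z₀, ∀ k ∈ K, m / 2 < Λ z k := by
    apply hK.eventually_forall_of_forall_eventually
    intro k hk
    have hca : ContinuousAt (fun p : W × W ↦ Λ p.1 p.2) (z₀, k) := hΛc.continuousAt
    exact hca.eventually (Ioi_mem_nhds (by linarith [hmle k hk]))
  have hev2 : ∀ᶠ z in 𝓝 z₀, T / 2 < fR z :=
    hfRc.continuousAt.eventually (Ioi_mem_nhds (by linarith))
  obtain ⟨O, hO, hOo, hz₀O⟩ := eventually_nhds_iff.1 (hev.and hev2)
  refine ⟨O, hOo, hz₀O, m / 2, by linarith, fun z hz ↦ ⟨?_, fun k hk hkal ↦ ?_⟩⟩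
  · -- `z ≠ k₁`
    intro hzk
    have h1 : T / 2 < fR z := (hO z hz).2
    have h2 : fR z ≤ dR z k₁ := ENNReal.toReal_mono (hfin _ _) (hfle z k₁ hk₁)
    have h3 : dR z k₁ = 0 := by
      show (edist z k₁).toReal = 0
      rw [hzk, edist_self, ENNReal.toReal_zero]
    linarith
  · -- the margin at an almost-nearest point
    have h1 : m / 2 < Λ z k := (hO z hz).1 k hk
    have h2 : dR z k - fR z ≤ m / 2 := by
      have h3 := ENNReal.toReal_mono (ENNReal.add_ne_top.2 ⟨hffin z, ENNReal.ofReal_ne_top⟩) hkal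
      rw [ENNReal.toReal_add (hffin z) ENNReal.ofReal_ne_top,
        ENNReal.toReal_ofReal (by linarith)] at h3
      change dR z k ≤ fR z + m / 2 at h3
      linarith
    have h3 : m / 2 < Θ z k := by
      rcases le_or_gt (Θ z k) (dR z k - fR z) with hle | hgt
      · have : Λ z k = dR z k - fR z := max_eq_right hle
        linarith
      · have : Λ z k = Θ z k := max_eq_left hgt.le
        linarith
    have h4 : 0 < dR z k₁ ^ 2 + dR z k ^ 2 - dR k₁ k ^ 2 - 2 * μ * dR z k₁ * dR z k := by
      have : (0 : ℝ) < Θ z k := by linarith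
      exact this
    have h5 := hcos z k₁ k
    change (dR z k₁ ^ 2 + dR z k ^ 2 - dR k₁ k ^ 2) / 2 ≤ _ at h5
    change μ * dR z k₁ * dR z k ≤ _
    linarith


set_option backward.isDefEq.respectTransparency false in
set_option maxHeartbeats 3200000 in
/-- **Stub E1 (`gradientLikeField`, the apex).** Let `(W, G)` be Cartan–Hadamard (closed balls
compact, simply connected, `sec ≤ 0`) and `K ⊆ W` compact with the `ρ`-spread property, `ρ < √2`:
any two nearest points `k₁, k₂ ∈ K` of a point `y ∉ K` satisfy `d(k₁,k₂) ≤ ρ d(y,K)`. Then for every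
`a > 0` there are a smooth vector field `X` with `|X|_G ≤ 1`, constants `δ > 0`, `R₀ > 0`, a point `o`
and a diffeomorphism `e : ℝ⁵ ≅ W` with `e 0 = o` and `d(o, e v) = |v|_{G_o}` such that
(i) `f = d(·,K)` grows at rate `≥ δ` along every integral curve of `X` started in `{f ≥ a}`, and
(ii) `X = e_*(v/|v|_{G_o})` at `e v` whenever `|v|_{G_o} ≥ R₀`.
Proof: Grove–Shiohama critical point theory of distance functions — see the module docstring;
inputs: stubs R (Rauch comparison) and L (calibration) through helper 1, helpers 2–6.
[cite: GroveShiohama1977, §1; Petersen2016, §12.1] -/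
theorem stub_gradientLikeField
    (W : Type) [TopologicalSpace W] [T2Space W] [SecondCountableTopology W]
    [ChartedSpace (EuclideanSpace ℝ (Fin 5)) W] [IsManifold (𝓡 5) ∞ W] [SimplyConnectedSpace W]
    (G : PseudoRiemannianMetric (𝓡 5) ∞ (EuclideanSpace ℝ (Fin 5)) (TangentSpace (𝓡 5) : W → Type _))
    (hG : G.IsRiemannian)
    (hcpt : ∀ (x : W) (r : NNReal), IsCompact {y : W | G.edist hG x y ≤ r})
    (hsec : ∀ cov, G.IsLeviCivita cov →
      ∀ (x : W) (X Y : TangentSpace (𝓡 5) x), G.sectionalCurvature cov x X Y ≤ 0)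
    (K : Set W) (hK : IsCompact K) (ρ : ℝ) (hρ : ρ < Real.sqrt 2)
    (hspread : ∀ y ∈ Kᶜ, ∀ k₁ ∈ K, ∀ k₂ ∈ K,
      G.edist hG y k₁ = ⨅ k ∈ K, G.edist hG y k → G.edist hG y k₂ = ⨅ k ∈ K, G.edist hG y k →
      G.edist hG k₁ k₂ ≤ ENNReal.ofReal ρ * ⨅ k ∈ K, G.edist hG y k)
    (a : ℝ) (ha : 0 < a) :
    ∃ (X : Π y : W, TangentSpace (𝓡 5) y) (δ : ℝ) (o : W) (R₀ : ℝ)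
      (e : EuclideanSpace ℝ (Fin 5) ≃ₘ^∞⟮𝓡 5, 𝓡 5⟯ W),
      0 < δ ∧ 0 < R₀ ∧
      ContMDiff (𝓡 5) (𝓡 5).tangent ∞ (fun y ↦ (⟨y, X y⟩ : TangentBundle (𝓡 5) W)) ∧
      (∀ y : W, G.val y (X y) (X y) ≤ 1) ∧
      (∀ (γ : ℝ → W) (t₁ t₂ : ℝ), t₁ ≤ t₂ → IsMIntegralCurveOn γ X (Icc t₁ t₂) →
        ENNReal.ofReal a ≤ ⨅ k ∈ K, G.edist hG (γ t₁) k →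
        (⨅ k ∈ K, G.edist hG (γ t₁) k) + ENNReal.ofReal (δ * (t₂ - t₁)) ≤
          ⨅ k ∈ K, G.edist hG (γ t₂) k) ∧
      e 0 = o ∧
      (∀ v : EuclideanSpace ℝ (Fin 5),
        G.edist hG o (e v) = ENNReal.ofReal (Real.sqrt (G.val o v v))) ∧
      (∀ v : EuclideanSpace ℝ (Fin 5), R₀ ≤ Real.sqrt (G.val o v v) →
        X (e v) = mfderiv (𝓡 5) (𝓡 5) e v ((Real.sqrt (G.val o v v))⁻¹ • v)) := by
  -- ### the polar package and the base point
  obtain ⟨Ex, h0, hpol, hlip, hgauss, hrev⟩ := helper_gradientLikeField_1 W G hG hcpt hsec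
  haveI : PathConnectedSpace W := inferInstance
  obtain ⟨o⟩ : Nonempty W := inferInstance
  set e := Ex o with he
  -- positive semidefiniteness of `G`
  have hnn : ∀ (x : W) (v : TangentSpace (𝓡 5) x), 0 ≤ G.val x v v := fun x v ↦ by
    by_cases hv : v = 0
    · subst hv; simp
    · exact (hG x v hv).le
  -- ### the distance structure; `f = infEDist(·, K)`; finiteness
  letI := G.riemannianBundle hG
  haveI := G.isContinuousRiemannianBundle hG
  haveI : LocallyCompactSpace W := ChartedSpace.locallyCompactSpace (EuclideanSpace ℝ (Fin 5)) W
  letI : PseudoEMetricSpace W := .ofRiemannianMetric (𝓡 5) W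
  have hed : ∀ y z : W, G.edist hG y z = edist y z := fun _ _ ↦ rfl
  set f : W → ℝ≥0∞ := fun y ↦ ⨅ k ∈ K, G.edist hG y k with hf
  have hfE : ∀ y : W, f y = Metric.infEDist y K := fun _ ↦ rfl
  have hfin : ∀ y z : W, G.edist hG y z ≠ ⊤ := edist_ne_top_of_polar G hG Ex hpol
  have hfc : Continuous f := by
    have : Continuous fun y : W ↦ Metric.infEDist y K := Metric.continuous_infEDist
    exact this
  have hfle : ∀ (y : W), ∀ k ∈ K, f y ≤ G.edist hG y k := fun y k hk ↦ by
    rw [hfE, hed]; exact Metric.infEDist_le_edist_of_mem hk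
  -- the radius function `r = d(o, ·)`
  set r : W → ℝ := fun z ↦ (G.edist hG o z).toReal with hr
  have hrc : Continuous r :=
    ENNReal.continuousOn_toReal.comp_continuous
      ((G.continuous_edist hG).comp (Continuous.prodMk_right o)) fun z ↦ hfin o z
  have hre : ∀ v : EuclideanSpace ℝ (Fin 5), r (e v) = Real.sqrt (G.val o v v) := fun v ↦ by
    show (G.edist hG o (Ex o v)).toReal = _
    rw [hpol, ENNReal.toReal_ofReal (Real.sqrt_nonneg _)]
  have hro : r o = 0 := by
    show (G.edist hG o o).toReal = 0
    rw [G.edist_self hG, ENNReal.toReal_zero]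
  -- ### constants
  set ρp : ℝ := max ρ 0 with hρp
  have hρp2 : ρp ^ 2 < 2 := by
    rcases le_or_gt 0 ρ with h | h
    · rw [hρp, max_eq_left h]
      have h2 : Real.sqrt 2 ^ 2 = 2 := Real.sq_sqrt (by norm_num)
      nlinarith [hρ, Real.sqrt_nonneg 2]
    · rw [hρp, max_eq_right h.le]; norm_num
  set μ : ℝ := min (1 / 2) ((2 - ρp ^ 2) / 4) with hμ
  have hμ0 : 0 < μ := lt_min (by norm_num) (by linarith)
  have hμh : μ ≤ 1 / 2 := min_le_left _ _
  have hμρ : 2 * μ < 2 - (max ρ 0) ^ 2 := by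
    have : μ ≤ (2 - ρp ^ 2) / 4 := min_le_right _ _
    rw [← hρp]; linarith
  -- the bound `D ≥ d(o, k)` on `K`
  obtain ⟨C₀, hC₀⟩ := hK.exists_bound_of_continuousOn (f := fun k ↦ (G.edist hG o k).toReal)
    hrc.continuousOn
  set D : ℝ := max C₀ 0 with hD
  have hD0 : 0 ≤ D := le_max_right _ _
  have hDK : ∀ k ∈ K, G.edist hG o k ≤ ENNReal.ofReal D := by
    intro k hk
    have h1 : (G.edist hG o k).toReal ≤ D := by
      have := hC₀ k hk
      rw [Real.norm_eq_abs, abs_of_nonneg ENNReal.toReal_nonneg] at this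
      exact this.trans (le_max_left _ _)
    exact (ENNReal.le_ofReal_iff_toReal_le (hfin o k) hD0).2 h1
  set R₁ : ℝ := 2 * D + 1 with hR₁
  set R₀ : ℝ := R₁ + 1 with hR₀
  have hR₀0 : 0 < R₀ := by rw [hR₀, hR₁]; linarith
  -- ### the smooth unit radial fields `Y p` (helper 6)
  have hY := fun p : W ↦ helper_gradientLikeField_6 W G hG Ex h0 hpol hgauss hrev p
  choose Y hYs hYunit hYeq hYrad using hY
  -- ### the uniform almost-nearest scale `η` (finite cover of the compact near region)
  set Cn : Set W := {z : W | G.edist hG o z ≤ ((R₁.toNNReal : NNReal) : ℝ≥0∞)} ∩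
    {z : W | ENNReal.ofReal (a / 2) ≤ f z} with hCn
  have hCnc : IsCompact Cn :=
    (hcpt o R₁.toNNReal).inter_right (isClosed_le continuous_const hfc)
  have hR₁0 : 0 ≤ R₁ := by rw [hR₁]; linarith
  have hmemCn : ∀ z : W, r z ≤ R₁ → ENNReal.ofReal (a / 2) ≤ f z → z ∈ Cn := by
    intro z hz hfz
    refine ⟨?_, hfz⟩
    show G.edist hG o z ≤ ((R₁.toNNReal : NNReal) : ℝ≥0∞)
    have : G.edist hG o z ≤ ENNReal.ofReal R₁ := (ENNReal.le_ofReal_iff_toReal_le (hfin o z) hR₁0).2 hz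
    exact this
  have hcover : ∃ η : ℝ, 0 < η ∧ ∀ x ∈ Cn, K.Nonempty → ∃ (k₁ : W) (O : Set W), IsOpen O ∧ x ∈ O ∧
      (∀ z ∈ O, z ≠ k₁) ∧
      ∀ z ∈ O, ∀ k ∈ K, G.edist hG z k ≤ (⨅ k' ∈ K, G.edist hG z k') + ENNReal.ofReal η →
        μ * (G.edist hG z k₁).toReal * (G.edist hG z k).toReal ≤
          G.val z ((Ex z).symm k₁) ((Ex z).symm k) := by
    rcases K.eq_empty_or_nonempty with hKe | hKne
    · exact ⟨1, one_pos, fun x _ hne ↦ absurd hne (by rw [hKe]; exact Set.not_nonempty_empty)⟩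
    -- local data at every point of `Cn` (helper 4 at a nearest point)
    have hloc : ∀ x ∈ Cn, ∃ (k₁ : W) (O : Set W), IsOpen O ∧ x ∈ O ∧ ∃ η₀ : ℝ, 0 < η₀ ∧
        ∀ z ∈ O, z ≠ k₁ ∧ ∀ k ∈ K,
          G.edist hG z k ≤ (⨅ k' ∈ K, G.edist hG z k') + ENNReal.ofReal η₀ →
          μ * (G.edist hG z k₁).toReal * (G.edist hG z k).toReal ≤
            G.val z ((Ex z).symm k₁) ((Ex z).symm k) := by
      intro x hx
      obtain ⟨k₁, hk₁K, hk₁⟩ := hK.exists_infEDist_eq_edist hKne x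
      have hfx : 0 < ⨅ k ∈ K, G.edist hG x k :=
        lt_of_lt_of_le (ENNReal.ofReal_pos.2 (by linarith)) hx.2
      have hnear : G.edist hG x k₁ = ⨅ k ∈ K, G.edist hG x k := hk₁.symm
      obtain ⟨O, hOo, hxO, η₀, hη₀, hO⟩ := helper_gradientLikeField_4 W G hG Ex hpol hlip K hK ρ μ
        hμ0 hμρ hspread x k₁ hk₁K hfx hnear
      exact ⟨k₁, O, hOo, hxO, η₀, hη₀, hO⟩
    choose! k₁f Of hOo hxO ηf hη0 hO using hloc
    obtain ⟨T, hTC, hTcov⟩ := hCnc.elim_nhds_subcover Of fun x hx ↦ (hOo x hx).mem_nhds (hxO x hx)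
    -- the uniform scale: minimum of the finitely many `η_x` and `1`
    set S : Finset ℝ := insert 1 (T.image ηf) with hS
    have hSne : S.Nonempty := ⟨1, Finset.mem_insert_self _ _⟩
    set η : ℝ := S.min' hSne with hη
    have hη0' : 0 < η := by
      rw [hη, Finset.lt_min'_iff]
      intro y hy
      rcases Finset.mem_insert.1 hy with rfl | hy
      · exact one_pos
      · obtain ⟨x, hxT, rfl⟩ := Finset.mem_image.1 hy
        exact hη0 x (hTC x hxT)
    have hηle : ∀ x ∈ T, η ≤ ηf x := fun x hx ↦
      Finset.min'_le _ _ (Finset.mem_insert_of_mem (Finset.mem_image_of_mem _ hx))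
    refine ⟨η, hη0', fun x hx _ ↦ ?_⟩
    obtain ⟨i, hiT, hxi⟩ : ∃ i ∈ T, x ∈ Of i := by
      have := hTcov hx
      simpa only [mem_iUnion, exists_prop] using this
    have hiC : i ∈ Cn := hTC i hiT
    refine ⟨k₁f i, Of i, hOo i hiC, hxi, fun z hz ↦ (hO i hiC z hz).1, fun z hz k hk hkal ↦ ?_⟩
    refine (hO i hiC z hz).2 k hk (hkal.trans ?_)
    exact add_le_add le_rfl (ENNReal.ofReal_le_ofReal (hηle i hiT))
  obtain ⟨η, hη0, hcov⟩ := hcover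
  -- ### the admissible sets and their convexity
  set t : Π z : W, Set (TangentSpace (𝓡 5) z) := fun z ↦
    {Yv | G.val z Yv Yv ≤ 1 ∧
      (ENNReal.ofReal (a / 2) ≤ (⨅ k ∈ K, G.edist hG z k) → ∀ k ∈ K,
        G.edist hG z k ≤ (⨅ k' ∈ K, G.edist hG z k') + ENNReal.ofReal η →
        μ * (G.edist hG z k).toReal ≤ -(G.val z ((Ex z).symm k) Yv)) ∧
      (R₀ ≤ r z → Yv = Y o z)} with ht
  have htc : ∀ z : W, Convex ℝ (t z) := by
    intro z Y₁ hY₁ Y₂ hY₂ c₁ c₂ hc₁ hc₂ hcs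
    refine ⟨?_, ?_, ?_⟩
    · -- the unit ball of `G_z` is convex (Cauchy–Schwarz)
      have h1 := hY₁.1
      have h2 := hY₂.1
      have hcs' : |G.val z Y₁ Y₂| ≤ 1 := by
        have h := Literature.Geometry.Riemannian.abs_val_le_sqrt_mul_sqrt G hnn z Y₁ Y₂
        have hs1 : Real.sqrt (G.val z Y₁ Y₁) ≤ 1 := Real.sqrt_le_one.mpr h1 |>.trans_eq rfl
        have hs2 : Real.sqrt (G.val z Y₂ Y₂) ≤ 1 := Real.sqrt_le_one.mpr h2
        calc |G.val z Y₁ Y₂| ≤ Real.sqrt (G.val z Y₁ Y₁) * Real.sqrt (G.val z Y₂ Y₂) := h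
          _ ≤ 1 * 1 := mul_le_mul hs1 hs2 (Real.sqrt_nonneg _) zero_le_one
          _ = 1 := one_mul 1
      have h_a : G.val z (c₁ • Y₁ + c₂ • Y₂) = c₁ • G.val z Y₁ + c₂ • G.val z Y₂ := by
        rw [map_add, map_smul, map_smul]
      have h_b : ∀ Yv : TangentSpace (𝓡 5) z, G.val z Yv (c₁ • Y₁ + c₂ • Y₂) =
          c₁ * G.val z Yv Y₁ + c₂ * G.val z Yv Y₂ := by
        intro Yv
        rw [map_add, map_smul, map_smul, smul_eq_mul, smul_eq_mul]
      have hexp : G.val z (c₁ • Y₁ + c₂ • Y₂) (c₁ • Y₁ + c₂ • Y₂) =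
          c₁ * c₁ * G.val z Y₁ Y₁ + 2 * c₁ * c₂ * G.val z Y₁ Y₂ + c₂ * c₂ * G.val z Y₂ Y₂ := by
        rw [h_a, _root_.add_apply, _root_.smul_apply, _root_.smul_apply, h_b, h_b,
          G.symm z Y₂ Y₁, smul_eq_mul, smul_eq_mul]
        ring
      rw [hexp]
      have hab : |G.val z Y₁ Y₂| ≤ 1 := hcs'
      rw [abs_le] at hab
      nlinarith [mul_nonneg hc₁ hc₂, hab.1, hab.2, h1, h2, sq_nonneg c₁, sq_nonneg c₂]
    · intro hfz k hk hkal
      have h1 := hY₁.2.1 hfz k hk hkal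
      have h2 := hY₂.2.1 hfz k hk hkal
      have hexp : G.val z ((Ex z).symm k) (c₁ • Y₁ + c₂ • Y₂) =
          c₁ * G.val z ((Ex z).symm k) Y₁ + c₂ * G.val z ((Ex z).symm k) Y₂ := by
        rw [map_add, map_smul, map_smul, smul_eq_mul, smul_eq_mul]
      rw [hexp]
      have : μ * (G.edist hG z k).toReal = c₁ * (μ * (G.edist hG z k).toReal) +
          c₂ * (μ * (G.edist hG z k).toReal) := by rw [← add_mul, hcs, one_mul]
      rw [this]
      nlinarith [mul_le_mul_of_nonneg_left h1 hc₁, mul_le_mul_of_nonneg_left h2 hc₂]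
    · intro hR
      rw [hY₁.2.2 hR, hY₂.2.2 hR, ← add_smul, hcs, one_smul]
  -- ### local realisability
  have hzero : ∀ U : Set W, ContMDiffOn (𝓡 5) ((𝓡 5).prod 𝓘(ℝ, EuclideanSpace ℝ (Fin 5))) ∞
      (fun z : W ↦ TotalSpace.mk' (EuclideanSpace ℝ (Fin 5)) z (0 : TangentSpace (𝓡 5) z)) U :=
    fun U ↦ (contMDiff_zeroSection ℝ (TangentSpace (𝓡 5) : W → Type _)).contMDiffOn
  have Hloc : ∀ x : W, ∃ U ∈ 𝓝 x, ∃ sl : Π z : W, TangentSpace (𝓡 5) z,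
      ContMDiffOn (𝓡 5) ((𝓡 5).prod 𝓘(ℝ, EuclideanSpace ℝ (Fin 5))) ∞
        (fun z : W ↦ TotalSpace.mk' (EuclideanSpace ℝ (Fin 5)) z (sl z)) U ∧
      ∀ z ∈ U, sl z ∈ t z := by
    intro x
    by_cases hA : R₁ < r x
    · -- Case A (far): the radial field from `o`
      refine ⟨{z | R₁ < r z}, (isOpen_lt continuous_const hrc).mem_nhds hA, Y o, ?_, ?_⟩
      · refine (hYs o).mono fun z hz ↦ ?_
        intro hzo
        have : R₁ < r z := hz
        rw [hzo, hro] at this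
        linarith
      · intro z hz
        have hz' : R₁ < r z := hz
        have hzo : z ≠ o := by
          intro hzo; rw [hzo, hro] at hz'; linarith
        refine ⟨le_of_eq (hYunit o z hzo), fun _ k hk _ ↦ ?_, fun _ ↦ rfl⟩
        -- far-field margin: helper 5
        have hoz : ENNReal.ofReal (2 * D) ≤ G.edist hG o z := by
          refine (ENNReal.ofReal_le_iff_le_toReal (hfin o z)).2 ?_
          change 2 * D ≤ r z
          linarith
        have h5 := helper_gradientLikeField_5 W G hG Ex hpol hlip o z k D hD0 (hDK k hk) hoz
        have hrz : 0 < r z := by linarith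
        have hrz' : (G.edist hG o z).toReal = r z := rfl
        rw [hYeq o z hzo, map_neg, map_smul, smul_eq_mul, hrz']
        rw [hrz'] at h5
        have hsym : G.val z ((Ex z).symm k) ((Ex z).symm o) = G.val z ((Ex z).symm o) ((Ex z).symm k) :=
          G.symm z _ _
        rw [hsym, neg_neg]
        have hd0 : 0 ≤ (G.edist hG z k).toReal := ENNReal.toReal_nonneg
        rw [le_inv_mul_iff₀' hrz]
        have hle : μ * (G.edist hG z k).toReal * r z ≤ 1 / 2 * r z * (G.edist hG z k).toReal := by
          nlinarith [mul_nonneg (sub_nonneg.2 hμh) (mul_nonneg hd0 hrz.le)]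
        exact hle.trans h5
    · by_cases hB : f x < ENNReal.ofReal (a / 2)
      · -- Case B (`f < a/2`): the zero field
        refine ⟨{z | f z < ENNReal.ofReal (a / 2)} ∩ {z | r z < R₀}, ?_, fun _ ↦ 0, hzero _, ?_⟩
        · refine ((isOpen_lt hfc continuous_const).inter (isOpen_lt hrc continuous_const)).mem_nhds
            ⟨hB, ?_⟩
          show r x < R₀
          rw [hR₀]; linarith [le_of_not_gt hA]
        · intro z hz
          refine ⟨by simp, fun hfz ↦ absurd hfz (not_le.2 hz.1), fun hR ↦ absurd hR (not_le.2 hz.2)⟩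
      · -- Case C (near, `f ≥ a/2`, `r ≤ R₁`)
        have hxC : x ∈ Cn := hmemCn x (le_of_not_gt hA) (le_of_not_gt hB)
        by_cases hKne : K.Nonempty
        · obtain ⟨k₁, O, hOo, hxO, hOk, hmargin⟩ := hcov x hxC hKne
          refine ⟨O ∩ {z | r z < R₀}, ?_, Y k₁, ?_, ?_⟩
          · refine (hOo.inter (isOpen_lt hrc continuous_const)).mem_nhds ⟨hxO, ?_⟩
            show r x < R₀
            rw [hR₀]; linarith [le_of_not_gt hA]
          · exact (hYs k₁).mono fun z hz ↦ hOk z hz.1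
          · intro z hz
            have hzk : z ≠ k₁ := hOk z hz.1
            refine ⟨le_of_eq (hYunit k₁ z hzk), fun _ k hk hkal ↦ ?_,
              fun hR ↦ absurd hR (not_le.2 hz.2)⟩
            have hm := hmargin z hz.1 k hk hkal
            have hd1 : 0 < (G.edist hG z k₁).toReal := by
              refine ENNReal.toReal_pos ?_ (hfin z k₁)
              intro h0'
              exact hzk ((G.edist_eq_zero_iff hG).1 h0')
            have hd1' : (G.edist hG k₁ z).toReal = (G.edist hG z k₁).toReal := by
              rw [G.edist_comm hG]
            rw [hYeq k₁ z hzk, map_neg, map_smul, smul_eq_mul, hd1']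
            have hsym : G.val z ((Ex z).symm k) ((Ex z).symm k₁) =
                G.val z ((Ex z).symm k₁) ((Ex z).symm k) := G.symm z _ _
            rw [hsym, neg_neg, le_inv_mul_iff₀' hd1]
            calc μ * (G.edist hG z k).toReal * (G.edist hG z k₁).toReal
                = μ * (G.edist hG z k₁).toReal * (G.edist hG z k).toReal := by ring
              _ ≤ _ := hm
        · -- `K = ∅`: no directional constraint
          have hKe : K = ∅ := Set.not_nonempty_iff_eq_empty.1 hKne
          refine ⟨{z | r z < R₀}, (isOpen_lt hrc continuous_const).mem_nhds ?_, fun _ ↦ 0,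
            hzero _, ?_⟩
          · show r x < R₀
            rw [hR₀]; linarith [le_of_not_gt hA]
          · intro z hz
            refine ⟨by simp, fun _ k hk ↦ ?_, fun hR ↦ absurd hR (not_le.2 hz)⟩
            rw [hKe] at hk
            exact absurd hk (Set.notMem_empty k)
  -- ### the global smooth section
  obtain ⟨s, hs⟩ := exists_contMDiffSection_forall_mem_convex_of_local (𝓡 5)
    (n := (⊤ : ℕ∞)) (F_fiber := EuclideanSpace ℝ (Fin 5)) (TangentSpace (𝓡 5) : W → Type _) t htc
    (fun x ↦ by
      obtain ⟨U, hU, sl, hsl, hslt⟩ := Hloc x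
      exact ⟨U, hU, sl, hsl, hslt⟩)
  -- ### conclusions
  refine ⟨s, μ, o, R₀, e, hμ0, hR₀0, s.contMDiff, fun y ↦ (hs y).1, ?_, h0 o, hpol o, ?_⟩
  · -- Lyapunov growth: helper 3
    intro γ t₁ t₂ ht hγ hfa
    exact helper_gradientLikeField_3 W G hG Ex hpol hgauss hrev K hK s a μ η ha hμ0 hη0
      (fun z hz k hk hkal ↦ (hs z).2.1 hz k hk hkal) γ t₁ t₂ ht hγ hfa
  · -- the radial zone
    intro v hv
    have hR : R₀ ≤ r (e v) := by rw [hre]; exact hv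
    have h1 : s (e v) = Y o (e v) := (hs (e v)).2.2 hR
    rw [h1, he]
    exact hYrad o v



/-! ## The composition (kernel-checked; no `sorry` of its own) -/

/-- **Line `core-distance-morse` concludes the crux BY NAME.** Far immersivity (landed stub A of
line `Sketch`) gives `t₀`; far-is-far (landed stub C) feeds stub P; stub N gives `ρ < √2` and a
threshold `t₁`; at the level `s = min(t₀,t₁)/2` stub P supplies the slice/frontier package, stub E2 a
level `{f = a}` parametrised by `Σ`, stub E1 the gradient-like field for `K_s` (its proof
consumes stub R), and stub E3 the diffeomorphism `Σ ≅ S⁴`. -/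
theorem C0AhRecognition_of :
    Summit.SmoothPoincare4.SmoothPoincare4.Theses.InformationMetricHadamard.C0AhRecognition := by
  intro S g hg W _ _ _ _ _ _ G hG c Φ hc hcpt hsec hsm hinj hco hcl hasym
  -- the cross-section is nonempty (it is homotopy equivalent to `S⁴`)
  haveI : Nonempty S.carrier := by
    obtain ⟨e⟩ := S.nonempty_homotopyEquiv
    obtain ⟨p, hp⟩ : (Metric.sphere (0 : EuclideanSpace ℝ (Fin 5)) 1).Nonempty :=
      NormedSpace.sphere_nonempty.2 zero_le_one
    exact ⟨e.invFun ⟨p, hp⟩⟩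
  -- landed collar lemmas of line `Sketch`: far immersivity (A) and far-is-far (C)
  obtain ⟨t₀, ht₀, himm⟩ :=
    Sketch.stub_farCollarImmersive S.carrier g hg W G c Φ hc hasym
  have hfar : ∀ (x₀ : W) (R : NNReal), ∃ t ∈ Ioo (0 : ℝ) 1, ∀ (y : S.carrier) (l : ℝ),
      l ∈ Ioo (0 : ℝ) t → (R : ℝ≥0∞) < G.edist hG x₀ (Φ (y, l)) :=
    Sketch.stub_farCollarIsFar S.carrier g hg W G hG c Φ hc hsm hinj ⟨t₀, ht₀, himm⟩ hasym
  -- stub P below `t₀`, stub N below `t₁`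
  have hP := stub_farCollarPackage S.carrier W G hG Φ hsm hinj hcl t₀ ht₀ himm hfar
  obtain ⟨ρ, hρ, t₁, ht₁, hN⟩ :=
    stub_nearestPointSpread S.carrier g hg W G hG c Φ hc hcpt hsm hinj hco hcl hasym
  -- a level below both thresholds
  set s : ℝ := min t₀ t₁ / 2 with hs_def
  have hmin : 0 < min t₀ t₁ := lt_min ht₀.1 ht₁.1
  have hs0 : 0 < s := by rw [hs_def]; linarith
  have hst₀ : s < t₀ := by rw [hs_def]; linarith [min_le_left t₀ t₁]
  have hst₁ : s < t₁ := by rw [hs_def]; linarith [min_le_right t₀ t₁]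
  have hs1 : s < 1 := hst₀.trans ht₀.2
  obtain ⟨hopen, hclos, hfront, hKi, -, -, -⟩ := hP s ⟨hs0, hst₀⟩
  have hKc : IsCompact (Φ '' (univ ×ˢ Ioo (0 : ℝ) s))ᶜ := hco s ⟨hs0, hs1⟩
  have hKne : ((Φ '' (univ ×ˢ Ioo (0 : ℝ) s))ᶜ).Nonempty := hKi.mono interior_subset
  -- stub E2: a tiny level `{f = a}` parametrised by `Σ`
  obtain ⟨a₀, ha₀, hE2⟩ :=
    stub_nearLevelSection S.carrier W G hG hcpt Φ hsm hinj t₀ ht₀ himm s ⟨hs0, hst₀⟩ hopen hclos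
      hfront hKc
  have ha : 0 < a₀ / 2 := by linarith
  obtain ⟨j, hj, hjinj, hjimm, hjr⟩ := hE2 (a₀ / 2) ⟨ha, by linarith⟩
  -- stub E1: the gradient-like field for the far core `K_s`
  have hspread : ∀ y ∈ ((Φ '' (univ ×ˢ Ioo (0 : ℝ) s))ᶜ)ᶜ,
      ∀ k₁ ∈ (Φ '' (univ ×ˢ Ioo (0 : ℝ) s))ᶜ, ∀ k₂ ∈ (Φ '' (univ ×ˢ Ioo (0 : ℝ) s))ᶜ,
        G.edist hG y k₁ = ⨅ k ∈ (Φ '' (univ ×ˢ Ioo (0 : ℝ) s))ᶜ, G.edist hG y k →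
        G.edist hG y k₂ = ⨅ k ∈ (Φ '' (univ ×ˢ Ioo (0 : ℝ) s))ᶜ, G.edist hG y k →
        G.edist hG k₁ k₂ ≤
          ENNReal.ofReal ρ * ⨅ k ∈ (Φ '' (univ ×ˢ Ioo (0 : ℝ) s))ᶜ, G.edist hG y k := by
    intro y hy
    rw [compl_compl] at hy
    exact hN s ⟨hs0, hst₁⟩ y hy
  obtain ⟨X, δ, o, R₀, e, hδ, hR₀, hX, hXle, hlyap, he0, hedist, hrad⟩ :=
    stub_gradientLikeField W G hG hcpt hsec _ hKc ρ hρ hspread (a₀ / 2) ha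
  -- stub E3: flow the level onto a round sphere
  exact stub_flowToRoundSphere W G hG hcpt _ hKc hKne (a₀ / 2) ha X δ o R₀ e hδ hR₀ hX hXle hlyap
    he0 hedist hrad S.carrier j hj hjinj hjimm hjr


end Summit.SmoothPoincare4.SmoothPoincare4.Cruxes.C0AhRecognition.CoreDistanceMorse

end
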